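import Summits.CriticalPhenomena.CardyFormulaZ2.Theorems.CardyComplexConeEdgePrecompactUFRSCollarDecayRectSplit

/-!
# The per-box, per-scale bound of the two-scale collar certificate at the boundary of a rectangle
(line `qkz-strip-boundary-arm` of crux `CardyComplexCone.EdgePrecompact`, stmt-CriticalPhenomena-11387;
fourth support file of the registered sub-goal `ufrs_screenedCollarDecay_rect`, M3 of the UFRS road map)

For a boundary point `p` of the rectangle whose capped junction distance is `ŝ ∈ [64η, ρ/2]`
(`ŝ = 64η`: very near a marked edge, no screening; `ŝ > 64η`: no marked midpoint within `ŝ`) and a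
scale `d`, the FAR branch of the collar certificate transported to `p` reads "three strands across
`A(p; 8η, d/4)` (if `d ≥ 64η`) and three strands across `A(p; 3d, ρ/8)`". Under the normalised
single-scale bounds (`…UFRSCollarDecayRectSplit.lean`):

* `real_certScale_le` (registered sub-goal, `d ∈ [64η, ρ/64]`) — the two events are independent
  (`real_inter_eq_of_ball_beyond`) and the product of their bounds is at most
  `2^27 C₁⁴ (η/ŝ) (η/d)^{α/2} (d/ρ)^α` in every regime: `24 d ≤ ŝ` (inner annulus at the three-arm
  rate, outer annulus split at the junction scale), `ŝ < 24 d` (outer annulus at the one-arm rate,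
  inner annulus shrunk or split), `ŝ = 64η` (both at the one-arm rate) — the true rate
  `η^{1+α} ρ^{-α} / ŝ` times the slack `(ρ/d)^{α/2}`;
* `real_certScale_le_small` (`d ∈ [4η, 64η)`) — the outer annulus alone obeys the same bound;
* `real_certPiece_le` — both regimes as one event `{(64η ≤ d → inner) ∧ outer}`.

References: G. F. Lawler, O. Schramm, W. Werner, Electron. J. Probab. 7 (2002), App. A;
H. Kesten, Comm. Math. Phys. 109 (1987); P. Nolin, Electron. J. Probab. 13 (2008), §4.
-/

namespace Summit.CriticalPhenomena.CardyFormulaZ2.Cruxes.EdgePrecompact.QkzStripBoundaryArm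

open MeasureTheory Filter Set Metric
open scoped Topology BigOperators Pointwise
open Literature.Probability.LatticeModels Literature.Probability.Percolation
open Literature.Probability.RandomPlanarGeometry (DobrushinDomain)
open Summit.CriticalPhenomena.CardyFormulaZ2.Theses.CardyComplexCone

noncomputable section

/-! ## The per-box, per-scale bound -/

/-- **Per-box, per-scale bound, inner annulus present.** Normalised bridge at collar width `η`
(`hO`, `hF`), boundary point `p`, capped junction distance `ŝ ∈ [64η, ρ/2]` (junction-freeness
below `ŝ` available when `ŝ > 64η`), scale `d ∈ [64η, ρ/64]`: the probability of three strands
across `A(p; 8η, d/4)` AND three strands across `A(p; 3d, ρ/8)` is at most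
`2^27 C₁⁴ (η/ŝ) (η/d)^{α/2} (d/ρ)^α`. The two events are independent; each factor is bounded by
the one-arm rate or by `real_ufrsStrands_le_split`, according as the annulus lies below, across
or above the junction scale. -/
theorem real_certScale_le : ∀ (S : Set ℂ) (C₁ α η ρ : ℝ) (E : DiscreteDobrushin) (w : Site 2) (p : ℂ) (ŝ d : ℝ), 1 ≤ C₁ → 0 < α → α ≤ 1 → 0 < η → 0 < E.δ → E.δ ≤ η → (∀ (z : ℂ) (r R : ℝ), z ∈ S → 8 * η ≤ r → 2 * r ≤ R → (bondPercolation (zdGraph 2) half).real (ufrsStrands E w z 3 r R) ≤ C₁ * (r / R) ^ α) → (∀ (z : ℂ) (r R : ℝ), z ∈ S → 8 * η ≤ r → 2 * r ≤ R → z ∉ ufrsMarkedNbhd E w (2 * R) → (bondPercolation (zdGraph 2) half).real (ufrsStrands E w z 3 r R) ≤ C₁ * (r / R) ^ (1 + α)) → p ∈ S → 64 * η ≤ ŝ → ŝ ≤ ρ / 2 → (64 * η < ŝ → ∀ b' : ℝ, 2 * b' < ŝ → p ∉ ufrsMarkedNbhd E w (2 * b')) → 64 * η ≤ d → 64 * d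 ≤ ρ → (bondPercolation (zdGraph 2) half).real (ufrsStrands E w p 3 (8 * η) (d / 4) ∩ ufrsStrands E w p 3 (3 * d) (ρ / 8)) ≤ 2 ^ 27 * C₁ ^ 4 * (η / ŝ) * ((η / d) ^ (α / 2) * (d / ρ) ^ α) := by
  intro S C₁ α η ρ E w p ŝ d hC₁ hα hα1 hη hδ hδη hO hF hp hŝ hŝρ hfree hd hdρ
  set μ := bondPercolation (zdGraph 2) half with hμ
  have hd0 : 0 < d := by linarith
  have hρ0 : 0 < ρ := by linarith
  have hŝ0 : 0 < ŝ := by linarith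
  have hXY := rpow_pair_le hη hd hdρ hα hα1
  set Φ := (η / d) ^ (α / 2) * (d / ρ) ^ α with hΦ
  set X := (8 * η / (d / 4)) ^ α with hX
  set Y := (3 * d / (ρ / 8)) ^ α with hY
  have hΦ0 : 0 ≤ Φ := by positivity
  have hX0 : 0 ≤ X := by positivity
  have hY0 : 0 ≤ Y := by positivity
  have hC₁0 : 0 ≤ C₁ := by linarith
  have hC₁4 : C₁ ≤ C₁ ^ 4 := by
    have h1 : 1 ≤ C₁ ^ 3 := one_le_pow₀ hC₁
    nlinarith
  have hC₁24 : C₁ ^ 2 ≤ C₁ ^ 4 := by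
    have h1 : 1 ≤ C₁ ^ 2 := one_le_pow₀ hC₁
    nlinarith
  have hC₁34 : C₁ ^ 3 ≤ C₁ ^ 4 := by
    have h1 : 0 ≤ C₁ ^ 3 := by positivity
    nlinarith
  have hηŝ0 : 0 ≤ η / ŝ := by positivity
  -- the target absorbs every case: `K · C₁^j · (η/ŝ) · (X Y) ≤ 2^27 C₁⁴ (η/ŝ) Φ` for `768 K ≤ 2^27`
  have absorb : ∀ (K : ℝ) (j : ℕ), 0 ≤ K → 768 * K ≤ 2 ^ 27 → C₁ ^ j ≤ C₁ ^ 4 →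
      K * C₁ ^ j * (η / ŝ) * (X * Y) ≤ 2 ^ 27 * C₁ ^ 4 * (η / ŝ) * Φ := by
    intro K j hK hK' hj
    calc K * C₁ ^ j * (η / ŝ) * (X * Y) ≤ K * C₁ ^ 4 * (η / ŝ) * (768 * Φ) := by gcongr
      _ = (768 * K) * (C₁ ^ 4 * (η / ŝ) * Φ) := by ring
      _ ≤ 2 ^ 27 * (C₁ ^ 4 * (η / ŝ) * Φ) := mul_le_mul_of_nonneg_right hK' (by positivity)
      _ = 2 ^ 27 * C₁ ^ 4 * (η / ŝ) * Φ := by ring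
  -- independence of the two scales
  have hin_lt : 8 * η < d / 4 := by linarith
  have hout_lt : 3 * d < ρ / 8 := by linarith
  have hind : μ.real (ufrsStrands E w p 3 (8 * η) (d / 4) ∩ ufrsStrands E w p 3 (3 * d) (ρ / 8)) =
      μ.real (ufrsStrands E w p 3 (8 * η) (d / 4)) * μ.real (ufrsStrands E w p 3 (3 * d) (ρ / 8)) :=
    real_inter_eq_of_ball_beyond (R₁ := d / 4 + 2 * E.δ) (r₂ := 3 * d - 2 * E.δ) (by linarith)
      (determinedBy_ufrsStrands_ball hδ w p 3 hin_lt) (determinedBy_ufrsStrands_beyond hδ w p 3 hout_lt)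
      (measurableSet_ufrsStrands hδ w p 3 hin_lt) (measurableSet_ufrsStrands hδ w p 3 hout_lt)
  rw [hind]
  -- the one-arm bounds, always available
  have hI1 : μ.real (ufrsStrands E w p 3 (8 * η) (d / 4)) ≤ C₁ * X :=
    hO p (8 * η) (d / 4) hp le_rfl (by linarith)
  have hO1 : μ.real (ufrsStrands E w p 3 (3 * d) (ρ / 8)) ≤ C₁ * Y :=
    hO p (3 * d) (ρ / 8) hp (by linarith) (by linarith)
  by_cases hfar : 64 * η < ŝ
  · have hfree' := hfree hfar
    -- inner factor, screened
    have hI2 : μ.real (ufrsStrands E w p 3 (8 * η) (d / 4)) ≤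
        16 * C₁ ^ 2 * (8 * η / min ŝ (d / 4)) * X :=
      real_ufrsStrands_le_split S C₁ α η E w p ŝ _ _ hC₁ hα hα1 hη hδ hδη hO hF hp hfree' le_rfl
        (by linarith) (by linarith)
    by_cases hds : 24 * d ≤ ŝ
    · -- outer factor screened as well
      have hO2 : μ.real (ufrsStrands E w p 3 (3 * d) (ρ / 8)) ≤
          16 * C₁ ^ 2 * (3 * d / min ŝ (ρ / 8)) * Y :=
        real_ufrsStrands_le_split S C₁ α η E w p ŝ _ _ hC₁ hα hα1 hη hδ hδη hO hF hp hfree' (by linarith)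
          (by linarith) (by linarith)
      have hmin1 : min ŝ (d / 4) = d / 4 := min_eq_right (by linarith)
      have hmin2 : ŝ / 4 ≤ min ŝ (ρ / 8) := le_min (by linarith) (by linarith)
      have hcoef1 : 8 * η / min ŝ (d / 4) = 32 * (η / d) := by rw [hmin1]; field_simp; ring
      have hcoef2 : 3 * d / min ŝ (ρ / 8) ≤ 12 * (d / ŝ) := by
        rw [div_le_iff₀ (lt_of_lt_of_le (by positivity) hmin2)]
        have : 12 * (d / ŝ) * (ŝ / 4) = 3 * d := by field_simp; ring
        nlinarith [this]
      have hprod : (16 * C₁ ^ 2 * (32 * (η / d))) * (16 * C₁ ^ 2 * (12 * (d / ŝ))) =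
          98304 * C₁ ^ 4 * (η / ŝ) := by
        field_simp; ring
      calc μ.real (ufrsStrands E w p 3 (8 * η) (d / 4)) * μ.real (ufrsStrands E w p 3 (3 * d) (ρ / 8))
          ≤ (16 * C₁ ^ 2 * (8 * η / min ŝ (d / 4)) * X) * (16 * C₁ ^ 2 * (3 * d / min ŝ (ρ / 8)) * Y) :=
            mul_le_mul hI2 hO2 measureReal_nonneg (by positivity)
        _ ≤ (16 * C₁ ^ 2 * (32 * (η / d)) * X) * (16 * C₁ ^ 2 * (12 * (d / ŝ)) * Y) := by
            rw [hcoef1]; gcongr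
        _ = (16 * C₁ ^ 2 * (32 * (η / d))) * (16 * C₁ ^ 2 * (12 * (d / ŝ))) * (X * Y) := by ring
        _ = 98304 * C₁ ^ 4 * (η / ŝ) * (X * Y) := by rw [hprod]
        _ ≤ 2 ^ 27 * C₁ ^ 4 * (η / ŝ) * Φ := absorb 98304 4 (by norm_num) (by norm_num) le_rfl
    · -- outer factor at the one-arm rate; inner coefficient bounded via `ŝ < 24 d`
      rw [not_le] at hds
      have hcoef1 : 8 * η / min ŝ (d / 4) ≤ 768 * (η / ŝ) := by
        rcases le_total ŝ (d / 4) with h | h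
        · rw [min_eq_left h, show 768 * (η / ŝ) = 768 * η / ŝ by ring, div_le_div_iff_of_pos_right hŝ0]
          linarith
        · rw [min_eq_right h, div_le_iff₀ (by positivity : (0:ℝ) < d / 4)]
          rw [show 768 * (η / ŝ) * (d / 4) = η * (192 * d) / ŝ by ring, le_div_iff₀ hŝ0]
          nlinarith
      calc μ.real (ufrsStrands E w p 3 (8 * η) (d / 4)) * μ.real (ufrsStrands E w p 3 (3 * d) (ρ / 8))
          ≤ (16 * C₁ ^ 2 * (8 * η / min ŝ (d / 4)) * X) * (C₁ * Y) :=
            mul_le_mul hI2 hO1 measureReal_nonneg (by positivity)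
        _ ≤ (16 * C₁ ^ 2 * (768 * (η / ŝ)) * X) * (C₁ * Y) := by gcongr
        _ = 12288 * C₁ ^ 3 * (η / ŝ) * (X * Y) := by ring
        _ ≤ 2 ^ 27 * C₁ ^ 4 * (η / ŝ) * Φ := absorb 12288 3 (by norm_num) (by norm_num) hC₁34
  · -- very near a junction: `ŝ = 64 η`, both factors at the one-arm rate
    have hŝeq : ŝ = 64 * η := le_antisymm (not_lt.1 hfar) hŝ
    have h64 : (1:ℝ) = 64 * (η / ŝ) := by rw [hŝeq]; field_simp
    calc μ.real (ufrsStrands E w p 3 (8 * η) (d / 4)) * μ.real (ufrsStrands E w p 3 (3 * d) (ρ / 8))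
        ≤ (C₁ * X) * (C₁ * Y) := mul_le_mul hI1 hO1 measureReal_nonneg (by positivity)
      _ = 1 * C₁ ^ 2 * (X * Y) := by ring
      _ = 64 * C₁ ^ 2 * (η / ŝ) * (X * Y) := by rw [h64]; ring
      _ ≤ 2 ^ 27 * C₁ ^ 4 * (η / ŝ) * Φ := absorb 64 2 (by norm_num) (by norm_num) hC₁24

/-- **Per-box, per-scale bound, inner annulus absent** (`4η ≤ d < 64η`): the probability of three
strands across `A(p; 3d, ρ/8)` alone is at most `2^27 C₁⁴ (η/ŝ) (η/d)^{α/2} (d/ρ)^α`. -/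
theorem real_certScale_le_small {S : Set ℂ} {C₁ α η ρ : ℝ} (hC₁ : 1 ≤ C₁) (hα : 0 < α) (hα1 : α ≤ 1)
    (hη : 0 < η) {E : DiscreteDobrushin} {w : Site 2} (hδ : 0 < E.δ) (hδη : E.δ ≤ η)
    (hO : ∀ (z : ℂ) (r R : ℝ), z ∈ S → 8 * η ≤ r → 2 * r ≤ R →
      (bondPercolation (zdGraph 2) half).real (ufrsStrands E w z 3 r R) ≤ C₁ * (r / R) ^ α)
    (hF : ∀ (z : ℂ) (r R : ℝ), z ∈ S → 8 * η ≤ r → 2 * r ≤ R → z ∉ ufrsMarkedNbhd E w (2 * R) →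
      (bondPercolation (zdGraph 2) half).real (ufrsStrands E w z 3 r R) ≤ C₁ * (r / R) ^ (1 + α))
    {p : ℂ} (hp : p ∈ S) {ŝ : ℝ} (hŝ : 64 * η ≤ ŝ) (hŝρ : ŝ ≤ ρ / 2)
    (hfree : 64 * η < ŝ → ∀ b' : ℝ, 2 * b' < ŝ → p ∉ ufrsMarkedNbhd E w (2 * b'))
    {d : ℝ} (hd : 4 * η ≤ d) (hd' : d < 64 * η) (hdρ : 64 * d ≤ ρ) :
    (bondPercolation (zdGraph 2) half).real (ufrsStrands E w p 3 (3 * d) (ρ / 8)) ≤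
      2 ^ 27 * C₁ ^ 4 * (η / ŝ) * ((η / d) ^ (α / 2) * (d / ρ) ^ α) := by
  set μ := bondPercolation (zdGraph 2) half with hμ
  have hd0 : 0 < d := by linarith
  have hρ0 : 0 < ρ := by linarith
  have hŝ0 : 0 < ŝ := by linarith
  have hYΦ := rpow_out_le hη hd hd' hα hα1 hρ0
  set Φ := (η / d) ^ (α / 2) * (d / ρ) ^ α with hΦ
  set Y := (3 * d / (ρ / 8)) ^ α with hY
  have hΦ0 : 0 ≤ Φ := by positivity
  have hY0 : 0 ≤ Y := by positivity
  have hC₁0 : 0 ≤ C₁ := by linarith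
  have hC₁4 : C₁ ≤ C₁ ^ 4 := by
    have h1 : 1 ≤ C₁ ^ 3 := one_le_pow₀ hC₁
    nlinarith
  have hC₁24 : C₁ ^ 2 ≤ C₁ ^ 4 := by
    have h1 : 1 ≤ C₁ ^ 2 := one_le_pow₀ hC₁
    nlinarith
  have hηŝ0 : 0 ≤ η / ŝ := by positivity
  have absorb : ∀ (K : ℝ) (j : ℕ), 0 ≤ K → 1536 * K ≤ 2 ^ 27 → C₁ ^ j ≤ C₁ ^ 4 →
      K * C₁ ^ j * (η / ŝ) * Y ≤ 2 ^ 27 * C₁ ^ 4 * (η / ŝ) * Φ := by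
    intro K j hK hK' hj
    calc K * C₁ ^ j * (η / ŝ) * Y ≤ K * C₁ ^ 4 * (η / ŝ) * (1536 * Φ) := by gcongr
      _ = (1536 * K) * (C₁ ^ 4 * (η / ŝ) * Φ) := by ring
      _ ≤ 2 ^ 27 * (C₁ ^ 4 * (η / ŝ) * Φ) := mul_le_mul_of_nonneg_right hK' (by positivity)
      _ = 2 ^ 27 * C₁ ^ 4 * (η / ŝ) * Φ := by ring
  have hO1 : μ.real (ufrsStrands E w p 3 (3 * d) (ρ / 8)) ≤ C₁ * Y :=
    hO p (3 * d) (ρ / 8) hp (by linarith) (by linarith)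
  by_cases hfar : 64 * η < ŝ
  · have hfree' := hfree hfar
    by_cases hds : 24 * d ≤ ŝ
    · have hO2 : μ.real (ufrsStrands E w p 3 (3 * d) (ρ / 8)) ≤ 16 * C₁ ^ 2 * (3 * d / min ŝ (ρ / 8)) * Y :=
        real_ufrsStrands_le_split S C₁ α η E w p ŝ _ _ hC₁ hα hα1 hη hδ hδη hO hF hp hfree' (by linarith)
          (by linarith) (by linarith)
      have hmin2 : ŝ / 4 ≤ min ŝ (ρ / 8) := le_min (by linarith) (by linarith)
      have hcoef2 : 3 * d / min ŝ (ρ / 8) ≤ 768 * (η / ŝ) := by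
        rw [div_le_iff₀ (lt_of_lt_of_le (by positivity) hmin2)]
        have h1 : 768 * (η / ŝ) * (ŝ / 4) = 192 * η := by field_simp; ring
        have h2 : 768 * (η / ŝ) * (ŝ / 4) ≤ 768 * (η / ŝ) * min ŝ (ρ / 8) :=
          mul_le_mul_of_nonneg_left hmin2 (by positivity)
        linarith
      calc μ.real (ufrsStrands E w p 3 (3 * d) (ρ / 8)) ≤ 16 * C₁ ^ 2 * (3 * d / min ŝ (ρ / 8)) * Y := hO2
        _ ≤ 16 * C₁ ^ 2 * (768 * (η / ŝ)) * Y := by gcongr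
        _ = 12288 * C₁ ^ 2 * (η / ŝ) * Y := by ring
        _ ≤ 2 ^ 27 * C₁ ^ 4 * (η / ŝ) * Φ := absorb 12288 2 (by norm_num) (by norm_num) hC₁24
    · rw [not_le] at hds
      have h1 : (1:ℝ) ≤ 1536 * (η / ŝ) := by
        rw [show 1536 * (η / ŝ) = 1536 * η / ŝ by ring, le_div_iff₀ hŝ0]; linarith
      calc μ.real (ufrsStrands E w p 3 (3 * d) (ρ / 8)) ≤ C₁ * Y := hO1
        _ = 1 * C₁ ^ 1 * 1 * Y := by ring
        _ ≤ 1 * C₁ ^ 1 * (1536 * (η / ŝ)) * Y := by gcongr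
        _ = 1536 * C₁ ^ 1 * (η / ŝ) * Y := by ring
        _ ≤ 2 ^ 27 * C₁ ^ 4 * (η / ŝ) * Φ := absorb 1536 1 (by norm_num) (by norm_num) (by rw [pow_one]; exact hC₁4)
  · have hŝeq : ŝ = 64 * η := le_antisymm (not_lt.1 hfar) hŝ
    have h64 : (1:ℝ) = 64 * (η / ŝ) := by rw [hŝeq]; field_simp
    calc μ.real (ufrsStrands E w p 3 (3 * d) (ρ / 8)) ≤ C₁ * Y := hO1
      _ = 1 * C₁ ^ 1 * Y := by ring
      _ = 64 * C₁ ^ 1 * (η / ŝ) * Y := by rw [h64]; ring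
      _ ≤ 2 ^ 27 * C₁ ^ 4 * (η / ŝ) * Φ := absorb 64 1 (by norm_num) (by norm_num) (by rw [pow_one]; exact hC₁4)


/-- **The per-box, per-scale bound, both regimes.** For `d ∈ [4η, ρ/64]` the event "three strands
across `A(p; 8η, d/4)` if `d ≥ 64η`, and three strands across `A(p; 3d, ρ/8)`" has probability at
most `2^27 C₁⁴ (η/ŝ) (η/d)^{α/2} (d/ρ)^α`. -/
theorem real_certPiece_le {S : Set ℂ} {C₁ α η ρ : ℝ} (hC₁ : 1 ≤ C₁) (hα : 0 < α) (hα1 : α ≤ 1)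
    (hη : 0 < η) {E : DiscreteDobrushin} {w : Site 2} (hδ : 0 < E.δ) (hδη : E.δ ≤ η)
    (hO : ∀ (z : ℂ) (r R : ℝ), z ∈ S → 8 * η ≤ r → 2 * r ≤ R →
      (bondPercolation (zdGraph 2) half).real (ufrsStrands E w z 3 r R) ≤ C₁ * (r / R) ^ α)
    (hF : ∀ (z : ℂ) (r R : ℝ), z ∈ S → 8 * η ≤ r → 2 * r ≤ R → z ∉ ufrsMarkedNbhd E w (2 * R) →
      (bondPercolation (zdGraph 2) half).real (ufrsStrands E w z 3 r R) ≤ C₁ * (r / R) ^ (1 + α))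
    {p : ℂ} (hp : p ∈ S) {ŝ : ℝ} (hŝ : 64 * η ≤ ŝ) (hŝρ : ŝ ≤ ρ / 2)
    (hfree : 64 * η < ŝ → ∀ b' : ℝ, 2 * b' < ŝ → p ∉ ufrsMarkedNbhd E w (2 * b'))
    {d : ℝ} (hd : 4 * η ≤ d) (hdρ : 64 * d ≤ ρ) :
    (bondPercolation (zdGraph 2) half).real
        {ω | (64 * η ≤ d → ω ∈ ufrsStrands E w p 3 (8 * η) (d / 4)) ∧ ω ∈ ufrsStrands E w p 3 (3 * d) (ρ / 8)} ≤
      2 ^ 27 * C₁ ^ 4 * (η / ŝ) * ((η / d) ^ (α / 2) * (d / ρ) ^ α) := by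
  by_cases h64 : 64 * η ≤ d
  · have hset : {ω | (64 * η ≤ d → ω ∈ ufrsStrands E w p 3 (8 * η) (d / 4)) ∧
        ω ∈ ufrsStrands E w p 3 (3 * d) (ρ / 8)} =
        ufrsStrands E w p 3 (8 * η) (d / 4) ∩ ufrsStrands E w p 3 (3 * d) (ρ / 8) := by
      ext ω
      simp only [Set.mem_setOf_eq, Set.mem_inter_iff, h64, forall_true_left]
    rw [hset]
    exact real_certScale_le S C₁ α η ρ E w p ŝ d hC₁ hα hα1 hη hδ hδη hO hF hp hŝ hŝρ hfree h64 hdρ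
  · rw [not_le] at h64
    refine le_trans (measureReal_mono (fun ω hω => hω.2) (measure_ne_top _ _)) ?_
    exact real_certScale_le_small hC₁ hα hα1 hη hδ hδη hO hF hp hŝ hŝρ hfree hd h64 hdρ


end

end Summit.CriticalPhenomena.CardyFormulaZ2.Cruxes.EdgePrecompact.QkzStripBoundaryArm
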